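import Literature.Computability.Complexity.KarpProblems
import HarnessLib

/-!
# GRAPH 3-COLOURABILITY: the language `THREECOL`

Companion of `KarpProblems.lean` (which has CHROMATIC NUMBER, Karp's problem 12, with the number
of colours `k` part of the instance). GRAPH 3-COLOURABILITY — "given a graph `G`, is `G`
3-colourable?" — is the fixed-`k` problem; it is NP-complete (Stockmeyer 1973; Garey, Johnson and
Stockmeyer 1976, who also keep it NP-complete on planar graphs of maximum degree 4; Garey–Johnson
[GT4]: GRAPH K-COLORABILITY is NP-complete for every fixed `K ≥ 3`).

* `threeColSet` — the yes-instances `⟨n, G⟩`, `G` a simple graph on `Fin n` with `G.Colorable 3`;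
* `THREECOL : Language Bool` — their codes under the tree's graph encoding `encodingGraph`
  (`boolPair (binary n) (row-major adjacency bits)`, `GraphEncodings.lean`), exactly as
  `HAMCIRCUIT` is built from `hamCircuitSet`;
* NP-completeness (`IsNPComplete THREECOL`) is PROVED in `ThreeColouringMachine.lean`
  (`THREECOL_isNPComplete`: `kSAT 3 ≤ₚ THREECOL` through the palette/OR-gadget graph of
  `ThreeColouringGraph.lean`, and `THREECOL ≤ₚ CHROMATIC ∈ NP`); no named fact is introduced here.

Deliberately not here: the planar / bounded-degree variants, `k`-colourability for other fixed `k`.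

## References

* [Stockmeyer1973] L. J. Stockmeyer, *Planar 3-colorability is polynomial complete*, ACM SIGACT
  News 5:3 (1973) 19–25.
* [GareyJohnsonStockmeyer1976] M. R. Garey, D. S. Johnson, L. J. Stockmeyer, *Some simplified
  NP-complete graph problems*, Theoret. Comput. Sci. 1 (1976) 237–267.
* [CLRS2009] T. H. Cormen, C. E. Leiserson, R. L. Rivest, C. Stein, *Introduction to Algorithms*,
  3rd ed. (2009), Problem 34-3 (graph coloring: 3-COLOR is NP-complete via 3-CNF-SAT).
-/

noncomputable section

open Computability

namespace Literature.Computability.Complexity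

/-- Yes-instances of GRAPH 3-COLOURABILITY: finite simple graphs `⟨n, G⟩` on `Fin n` admitting a
proper colouring with `3` colours (`SimpleGraph.Colorable 3`). [cite: GareyJohnson1979, A1.1 GT4 (GRAPH K-COLORABILITY, K = 3)] -/
def threeColSet : Set (Σ n, SimpleGraph (Fin n)) :=
  {G | G.2.Colorable 3}

/-- Unfolding lemma for `threeColSet`. [folklore] -/
theorem mem_threeColSet_iff (G : Σ n, SimpleGraph (Fin n)) : G ∈ threeColSet ↔ G.2.Colorable 3 :=
  Iff.rfl

/-- The language GRAPH 3-COLOURABILITY over `{0,1}`: the codes of the members of `threeColSet`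
under `encodingGraph` (as `HAMCIRCUIT` is built from `hamCircuitSet` in `KarpProblems.lean`).
[cite: GareyJohnson1979, A1.1 GT4 (GRAPH K-COLORABILITY, K = 3)] -/
def THREECOL : Language Bool :=
  encodingGraph.toLanguage threeColSet

/-- A code `⟨n, G⟩` is in `THREECOL` iff `G` is `3`-colourable. [folklore] -/
theorem encode_mem_THREECOL_iff (n : ℕ) (G : SimpleGraph (Fin n)) :
    encodingGraph.encode ⟨n, G⟩ ∈ THREECOL ↔ G.Colorable 3 :=
  encodingGraph.mem_toLanguage_iff threeColSet ⟨n, G⟩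

/-- The yes-instances of GRAPH 3-COLOURABILITY are the instances `(G, 3)` of CHROMATIC NUMBER.
[folklore] -/
theorem mem_threeColSet_iff_mem_chromaticSet (G : Σ n, SimpleGraph (Fin n)) :
    G ∈ threeColSet ↔ (G, 3) ∈ chromaticSet :=
  Iff.rfl

end Literature.Computability.Complexity

end
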